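import Mathlib
import HarnessLib
import Summits.Langlands.Statement
import Literature.NumberTheory.Automorphic.LocalLanglandsGLProofs
import Literature.NumberTheory.Automorphic.LocalConstantsProofs
import Literature.NumberTheory.GaloisRepresentations.LocalGaloisGroupProofs
import Literature.NumberTheory.GaloisRepresentations.LocalGaloisGroupFrobeniusProofs
import Literature.NumberTheory.Automorphic.AutomorphicRepsGLSatakeFlathProofs
import Literature.NumberTheory.GaloisRepresentations.LAdicRepFrobenius
import Literature.NumberTheory.Automorphic.ChebotarevArtinRepHolds
import Literature.NumberTheory.GaloisRepresentations.FramedRepEquivConj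
import Summits.Langlands.Langlands.Theorems.IrreducibilityBySelfDualityEssSelfDualIrreducibleCM
import Summits.Langlands.Langlands.Theorems.IrreducibilityBySelfDualityIrreducibleGL3CMFrame
import Summits.Langlands.Langlands.Theorems.IrreducibilityBySelfDualityGaloisRepOfRegularAlgebraicGL2CMSuffices
import Summits.Langlands.Langlands.Theorems.IrreducibilityBySelfDualityReducibleForcesEssSelfDual
import Literature.NumberTheory.GaloisRepresentations.PowLocallyAlgebraicProofs
import Literature.NumberTheory.GaloisRepresentations.AlgebraicHeckeCharacterGrossencharakterProofs
import Literature.NumberTheory.Automorphic.GLOneOfHeckeCharacterBJ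
import Literature.NumberTheory.Automorphic.GLOneArchParameterOfAlgebraicCharacter
import Summits.Langlands.Langlands.Theorems.IrreducibilityBySelfDualityAdjointLiftFromRegularTwist
import Summits.Langlands.Langlands.Theorems.IrreducibilityBySelfDualityHalfIntegralTwistCM
import Summits.Langlands.Langlands.Theorems.IrreducibilityBySelfDualityContragredientDatum
import Summits.Langlands.Langlands.Theorems.IrreducibilityBySelfDualityGaloisRepOfRegularAlgebraicOfLeaves
import Summits.Langlands.Langlands.Theorems.IrreducibilityBySelfDualityRegularTwistFromArchInputs
import Summits.Langlands.Langlands.Theorems.IrreducibilityBySelfDualityGaloisRepGL2CMaeOfLeaves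

/-!
# Route `IrreducibilityBySelfDuality` — the Assembly in the CRUX-ONLY frame of the REVISED summit, structural

The summit statement `_root_.Langlands` was re-typed by p141787 (2026-08-17, human ruling Q-L1):
`∀ F, Nonempty (ReciprocityData F) ∧ ∀ 𝓡 n, 0 < n → ∀ hcpt, GlobalLanglandsCorrespondenceGLn n F 𝓡 hcpt`
(formerly `∀ F, ∃ 𝓡, …`).  The route's deciding theorem
`Summit.Langlands.Langlands.Theses.IrreducibilityBySelfDuality.closes` (Theses rev 26–27) was re-typed
in lockstep: its hypotheses are the eight cruxes

  `RegularAdjointLiftCM`, `GaloisRepGL2CMae`, `SelfdualGL3AdjointLift`, `PairLBoundaryJS`,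
  `ContragredientDatum`, `HeckeEigenvalueField`, `IrreducibleOffSector`, `ReciprocityUpToIrreducibilityR`

(the last one = the ∃-Rec item `ReciprocityUpToIrreducibility` re-typed `Nonempty ∧ ∀ Rec`).  The old
bookkeeping item `Assembly` (stmt-Langlands-14093: the twelve rev-0–4 items with the ∃-Rec form of
reciprocity `→ Langlands`) and its structural proof module `Theorems/IrreducibilityBySelfDualityAssembly`
construct the OLD ∃-shaped summit; that module stopped building at the full build of 2026-08-17
(fix item `fix:Summits.Langlands.Langlands.Theorems.IrreducibilityBySelfDualityAssembly`), and with
`∀ 𝓡` its statement is no longer bookkeeping: one reciprocity datum does not give `Corresponds 𝓡` for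
every `𝓡` (`LocalGlobalCompatibleAt` reads `(𝓡.llc v).recGL n`; pinned-`rec` rigidity in rank `≥ 2`
is the open local stub `stub_recGL_eq_of_isGeneric_of_not_isSupercuspidal`).  The route file records the
residue (rev 27): "RESTATE Assembly (14093) to the curried crux-only frame".

THIS MODULE is the cycle-free structural proof for that restated frame, UNCURRIED:

  `RegularAdjointLiftCM ∧ GaloisRepGL2CMae ∧ SelfdualGL3AdjointLift ∧ PairLBoundaryJS ∧
   ContragredientDatum ∧ HeckeEigenvalueField ∧ IrreducibleOffSector ∧ ReciprocityUpToIrreducibilityR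
   → Langlands`

(the order of the thesis conjunction and of the hypotheses of `closes`).  As in the pattern of the old
module, the TYPE is spelled out STRUCTURALLY — the bodies of the eight route decls copied byte-for-byte
from `Summits/Langlands/Langlands/Theses/IrreducibilityBySelfDuality.lean` (rev 27; none of the eight
refers to another item by name), under the same `open`s — and this module imports what the Theses file
imports EXCEPT the Theses-only `HarnessLib.Audit` and the broken old assembly module, and NOT the Theses
module itself (the gate links a by-name item by importing the proving module INTO the Theses file; a
Theses import here would close an import cycle, the 2026-08-15T23:51Z incident).  Hence the type is
definitionally (syntactically, after δ) equal to the conjunction of the eight route decls `→ Langlands`;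
certified in the prover's folder by
`example : RegularAdjointLiftCM ∧ … ∧ ReciprocityUpToIrreducibilityR → _root_.Langlands :=
irreducibilityBySelfDuality_assemblyR` against the rev-27 Theses file (work/CheckDefeqR.lean, rc 0).
The statement text is generated mechanically from the Theses file (work/gen_r.py) — no hand edits
inside the type.

PROOF = the text of `closes` (Theses rev 27), verbatim after `rintro` of the 8-tuple; the only edit is
that the inline re-derivation of `WeakAbelianSummandHecke` (item 13620; Böckle–Hui Thm 1.1, cofinite
form, through the GL(1) dictionary) states its goal structurally instead of by name.  Then
`reducibleForcesEssSelfDual_of` (13619), `essSelfDualIrreducibleCM_of_gl2CM_ae` (13618 with Galois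
input `GaloisRepGL2CMae`), sector dispatch through the body of `IrreducibleGL3CM.frame_proof`
(cyclotomic untwist, continuous semisimplification, reducible companion), `IrreducibleOffSector` off
the sector, and uniqueness up to conjugacy by Chebotarev + Brauer–Nesbitt
(`FramedGaloisRep.nonempty_equiv_of_hasFrobCharpolyAt_eventually chebotarev_artinRep_holds`,
`FramedRep.exists_eq_conj_of_equiv`).  Axioms: `propext`, `Classical.choice`, `Quot.sound`.
-/

set_option linter.dupNamespace false -- project-wide option (lakefile weak.linter.dupNamespace); `Summit.Langlands.Langlands` is the mandated namespace

namespace Summit.Langlands.Langlands.Theorems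

-- the SAME `open`s as the route file, so that the copied bodies elaborate to the same terms
open scoped BigOperators Topology Manifold Classical MeasureTheory ProbabilityTheory Matrix InnerProductSpace ComplexConjugate ContinuousMap
open Filter Set Function TopologicalSpace MeasureTheory

/-- **Assembly of route `IrreducibilityBySelfDuality` in the crux-only frame of the revised summit**,
stated structurally: the conjunction of the eight cruxes of the deciding theorem `closes` —
(1) `RegularAdjointLiftCM` (Ramakrishnan's adjoint descent made regular algebraic over a CM field),
(2) `GaloisRepGL2CMae` (Harris–Lan–Taylor–Thorne Thm. A for `GL₂` over CM fields, a.e.),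
(3) `SelfdualGL3AdjointLift` (Ramakrishnan 2014 Thm. A), (4) `PairLBoundaryJS` (Jacquet–Shalika),
(5) `ContragredientDatum`, (6) `HeckeEigenvalueField` (Clozel), (7) `IrreducibleOffSector`,
(8) `ReciprocityUpToIrreducibilityR` (`Nonempty (ReciprocityData F)` and reciprocity up to
irreducibility for EVERY reciprocity datum) — implies the summit statement `Langlands`
(`∀ F, Nonempty (ReciprocityData F) ∧ ∀ 𝓡 n, 0 < n → ∀ hcpt, …`).  Definitionally equal to
`RegularAdjointLiftCM ∧ GaloisRepGL2CMae ∧ SelfdualGL3AdjointLift ∧ PairLBoundaryJS ∧ ContragredientDatum ∧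
HeckeEigenvalueField ∧ IrreducibleOffSector ∧ ReciprocityUpToIrreducibilityR → _root_.Langlands` over the
route decls of `Summit.Langlands.Langlands.Theses.IrreducibilityBySelfDuality`; proof = the route's
deciding theorem `closes`, uncurried (sector dispatch + Chebotarev–Brauer–Nesbitt uniqueness). [folklore] -/
theorem irreducibilityBySelfDuality_assemblyR :
      -- (1) RegularAdjointLiftCM (crux r2, stmt-Langlands-14324)
      ((∀ (F : Type) [Field F] [NumberField F] (hF1 : _) (hF2 : _) (hF3 : _) (P : Literature.NumberTheory.Automorphic.CuspidalAutomorphicRepData 3 F hF3) (η : Literature.NumberTheory.Automorphic.CuspidalAutomorphicRepData 1 F hF1), (∀ᶠ v in cofinite, ∀ α : Multiset ℂ, P.1.HasSatakeParamAt v α → ∃ e : ℂ, η.1.HasSatakeParamAt v {e} ∧ α.map (fun a => a⁻¹) = α.map (fun a => e * a)) → ∃ (π : Literature.NumberTheory.Automorphic.CuspidalAutomorphicRepData 2 F hF2) (ν : Literature.NumberTheory.Automorphic.CuspidalAutomorphicRepData 1 F hF1), (∀ (L : Type) [Field L] [NumberField L] [Algebra F L], Module.finrank F L = 2 → ¬ (∀ᶠ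 v in cofinite, ∀ β : Multiset ℂ, π.1.HasSatakeParamAt v β → β.map (fun b => (if ∃ w : IsDedekindDomain.HeightOneSpectrum (NumberField.RingOfIntegers L), w.asIdeal.under (NumberField.RingOfIntegers F) = v.asIdeal ∧ w.asIdeal.inertiaDeg (NumberField.RingOfIntegers F) = 1 then (1 : ℂ) else -1) * b) = β)) ∧ ∀ᶠ v in cofinite, ∀ β : Multiset ℂ, π.1.HasSatakeParamAt v β → ∃ d e : ℂ, ν.1.HasSatakeParamAt v {d} ∧ η.1.HasSatakeParamAt v {e} ∧ d ^ 2 * e = 1 ∧ P.1.HasSatakeParamAt v ((((β ×ˢ β).map (fun p : ℂ × ℂ => p.1 * p.2⁻¹)).erase 1).map (fun c => d * c))) → ∀ (K : Type) [Field K] [NumberField K], NumberField.IsCMField K → ∀ (h1 : _) (hcpt₂ : _) (hcpt : _) (π : Literature.NumberTheory.Automorphic.CuspidalAutomorphicRepData 3 K hcpt), π.1.IsRegularAlgebraic → (∃ η : Literature.NumberTheory.Automorphic.CuspidalAutomorphicRepData 1 K h1, ∀ᶠ v in cofinite, ∀ α : Multiset ℂ, π.1.HasSatakeParamAt v α → ∃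 e : ℂ, η.1.HasSatakeParamAt v {e} ∧ α.map (fun a => a⁻¹) = α.map (fun a => e * a)) → ∃ (σ : Literature.NumberTheory.Automorphic.CuspidalAutomorphicRepData 2 K hcpt₂) (ν : Literature.NumberTheory.Automorphic.CuspidalAutomorphicRepData 1 K h1), σ.1.IsRegularAlgebraic ∧ ν.1.IsRegularAlgebraic ∧ (∀ (L : Type) [Field L] [NumberField L] [Algebra K L], Module.finrank K L = 2 → ¬ (∀ᶠ v in cofinite, ∀ β : Multiset ℂ, σ.1.HasSatakeParamAt v β → β.map (fun b => (if ∃ w : IsDedekindDomain.HeightOneSpectrum (NumberField.RingOfIntegers L), w.asIdeal.under (NumberField.RingOfIntegers K) = v.asIdeal ∧ w.asIdeal.inertiaDeg (NumberField.RingOfIntegers K) = 1 then (1 : ℂ) else -1) * b) = β)) ∧ ∀ᶠ v in cofinite, ∀ α β : Multiset ℂ, π.1.HasSatakeParamAt v α → σ.1.HasSatakeParamAt v β → ∃ d : ℂ, ν.1.HasSatakeParamAt v {d} ∧ α = (((β ×ˢ β).map (fun p : ℂ × ℂ => p.1 * p.2⁻¹)).erase 1).map (fun c => d * c)) ∧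
      -- (2) GaloisRepGL2CMae (crux, stmt-Langlands-16722)
      (∀ (K : Type) [Field K] [NumberField K] (hcpt₂ : Literature.NumberTheory.Automorphic.isCompact_glFiniteIntegralLevel 2 K), NumberField.IsCMField K → ∀ (σ : Literature.NumberTheory.Automorphic.CuspidalAutomorphicRepData 2 K hcpt₂), σ.1.IsRegularAlgebraic → ∀ (ℓ : ℕ) [Fact ℓ.Prime] (ι : PadicAlgCl ℓ ≃+* ℂ), ∃ ρ : Literature.NumberTheory.GaloisRepresentations.FramedGaloisRep K (PadicAlgCl ℓ) 2, ∀ᶠ v : IsDedekindDomain.HeightOneSpectrum (NumberField.RingOfIntegers K) in Filter.cofinite, ∀ β : Multiset ℂ, σ.1.HasSatakeParamAt v β → ρ.IsUnramifiedAt v ∧ ρ.HasFrobCharpolyAt v (Literature.NumberTheory.Automorphic.arithFrobPolyOfSatake ι v.residueCard 2 β)) ∧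
      -- (3) SelfdualGL3AdjointLift (stmt-Langlands-14320)
      (∀ (F : Type) [Field F] [NumberField F] (hF1 : _) (hF2 : _) (hF3 : _) (P : Literature.NumberTheory.Automorphic.CuspidalAutomorphicRepData 3 F hF3) (η : Literature.NumberTheory.Automorphic.CuspidalAutomorphicRepData 1 F hF1), (∀ᶠ v in cofinite, ∀ α : Multiset ℂ, P.1.HasSatakeParamAt v α → ∃ e : ℂ, η.1.HasSatakeParamAt v {e} ∧ α.map (fun a => a⁻¹) = α.map (fun a => e * a)) → ∃ (π : Literature.NumberTheory.Automorphic.CuspidalAutomorphicRepData 2 F hF2) (ν : Literature.NumberTheory.Automorphic.CuspidalAutomorphicRepData 1 F hF1), (∀ (L : Type) [Field L] [NumberField L] [Algebra F L], Module.finrank F L = 2 → ¬ (∀ᶠ v in cofinite, ∀ β : Multiset ℂ, π.1.HasSatakeParamAt v β → β.map (fun b => (if ∃ w : IsDedekindDomain.HeightOneSpectrum (NumberField.RingOfIntegers L), w.asIdeal.under (NumberField.RingOfIntegers F) = v.asIdeal ∧ w.asIdeal.inertiaDeg (NumberField.RingOfIntegers F) = 1 then (1 : ℂ) else -1) * b)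 = β)) ∧ ∀ᶠ v in cofinite, ∀ β : Multiset ℂ, π.1.HasSatakeParamAt v β → ∃ d e : ℂ, ν.1.HasSatakeParamAt v {d} ∧ η.1.HasSatakeParamAt v {e} ∧ d ^ 2 * e = 1 ∧ P.1.HasSatakeParamAt v ((((β ×ˢ β).map (fun p : ℂ × ℂ => p.1 * p.2⁻¹)).erase 1).map (fun c => d * c))) ∧
      -- (4) PairLBoundaryJS (stmt-Langlands-14321)
      (∀ (n m : ℕ) (F : Type) [Field F] [NumberField F] (hF : _) (hF' : _), 0 < n → 0 < m → ∀ (π : Literature.NumberTheory.Automorphic.CuspidalAutomorphicRepData n F hF) (π' : Literature.NumberTheory.Automorphic.CuspidalAutomorphicRepData m F hF'), ∃ S₀ : Set (IsDedekindDomain.HeightOneSpectrum (NumberField.RingOfIntegers F)), S₀.Finite ∧ ∀ {S : Set (IsDedekindDomain.HeightOneSpectrum (NumberField.RingOfIntegers F))}, S.Finite → S₀ ⊆ S → ∀ {α β : IsDedekindDomain.HeightOneSpectrum (NumberField.RingOfIntegers F) → Multiset ℂ}, (∀ w ∉ S, π.1.HasSatakeParamAt w (α w)) → (∀ w ∉ S,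 π'.1.HasSatakeParamAt w (β w)) → (∀ w ∉ S, ‖(α w).prod‖ = 1) → (∀ w ∉ S, ‖(β w).prod‖ = 1) → ∀ {s₀ : ℂ}, s₀.re = 1 → ¬ (n = m ∧ ∀ᶠ w in cofinite, (α w).map ((((w.residueCard : ℂ) ^ (1 - s₀))) * ·) = (β w).map (·⁻¹)) → ∃ c : ℂ, c ≠ 0 ∧ Tendsto (fun s : ℂ => ∏' w : {w : IsDedekindDomain.HeightOneSpectrum (NumberField.RingOfIntegers F) // w ∉ S}, ((Literature.NumberTheory.Automorphic.satakePairPolynomial (α w.1) (β w.1)).eval ((w.1.residueCard : ℂ) ^ (-s)))⁻¹) (𝓝[{s : ℂ | 1 < s.re}] s₀) (𝓝 c)) ∧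
      -- (5) ContragredientDatum
      (∀ (n : ℕ) (K : Type) [Field K] [NumberField K] (hcpt : Literature.NumberTheory.Automorphic.isCompact_glFiniteIntegralLevel n K) (π : Literature.NumberTheory.Automorphic.CuspidalAutomorphicRepData n K hcpt), ∃ π' : Literature.NumberTheory.Automorphic.CuspidalAutomorphicRepData n K hcpt, ∀ (v : IsDedekindDomain.HeightOneSpectrum (NumberField.RingOfIntegers K)) (α : Multiset ℂ), π.1.HasSatakeParamAt v α → π'.1.HasSatakeParamAt v (α.map (·⁻¹))) ∧
      -- (6) HeckeEigenvalueField (stmt-Langlands-14323)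
      (∀ (n : ℕ) (K : Type) [Field K] [NumberField K] (hcpt : _) (π : Literature.NumberTheory.Automorphic.CuspidalAutomorphicRepData n K hcpt), π.1.IsRegularAlgebraic → ∃ E : Subfield ℂ, FiniteDimensional ℚ E ∧ ∀ᶠ v in cofinite, ∀ α : Multiset ℂ, π.1.HasSatakeParamAt v α → ∀ i ≤ n, ((((Real.sqrt (v.residueCard : ℝ)) : ℝ) : ℂ) ^ (i * (n - i))) * α.esymm i ∈ E) ∧
      -- (7) IrreducibleOffSector (crux r6, stmt-Langlands-14329)
      (∀ (n : ℕ) (K : Type) [Field K] [NumberField K] (hcpt : Literature.NumberTheory.Automorphic.isCompact_glFiniteIntegralLevel n K), 0 < n → ∀ (π : Literature.NumberTheory.Automorphic.CuspidalAutomorphicRepData n K hcpt), π.1.IsLAlgebraic → ¬ (n = 3 ∧ NumberField.IsCMField K ∧ ∃ T : Literature.NumberTheory.Automorphic.InfinityType K n, π.1.HasInfinityType T ∧ T.IsRegular) → ∀ (ℓ : ℕ) [Fact ℓ.Prime] (ι : PadicAlgCl ℓ ≃+* ℂ) (ρ : Literature.NumberTheory.GaloisRepresentations.FramedGaloisRep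 K (PadicAlgCl ℓ) n), (∀ᶠ v : IsDedekindDomain.HeightOneSpectrum (NumberField.RingOfIntegers K) in cofinite, SatakeFrobCompatibleAt ι π.1 ρ v) → ρ.toGaloisRep.IsIrreducible) ∧
      -- (8) ReciprocityUpToIrreducibilityR (crux r7, stmt-Langlands-17925)
      (∀ (F : Type) [Field F] [NumberField F], Nonempty (ReciprocityData F) ∧ ∀ (Rec : ReciprocityData F) (n : ℕ), 0 < n → ∀ hcpt : Literature.NumberTheory.Automorphic.isCompact_glFiniteIntegralLevel n F, (∀ π : Literature.NumberTheory.Automorphic.CuspidalAutomorphicRepData n F hcpt, π.1.IsLAlgebraic → ∀ (ℓ : ℕ) [Fact ℓ.Prime] (ι : PadicAlgCl ℓ ≃+* ℂ), ∃ ρ : Literature.NumberTheory.GaloisRepresentations.FramedGaloisRep F (PadicAlgCl ℓ) n, IsGeometricFramed Rec ρ ∧ Corresponds Rec ι π.1 ρ) ∧ GaloisToAutomorphic n Rec hcpt) →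
      _root_.Langlands := by
  rintro ⟨c2, i2, i3, i4, i5, i6, cO, cE⟩
  have hWA : (∀ (K : Type) [Field K] [NumberField K] (h1 : _) (ℓ : ℕ) [Fact ℓ.Prime] (n : ℕ) (E : Type) [Field E] [NumberField E] (e : E →+* PadicAlgCl ℓ) (ρ : Literature.NumberTheory.GaloisRepresentations.FramedGaloisRep K (PadicAlgCl ℓ) n), ρ.toGaloisRep.IsSemisimple → (∀ᶠ v in cofinite, ρ.IsUnramifiedAt v ∧ ∃ P : Polynomial E, ρ.HasFrobCharpolyAt v (P.map e)) → ∀ (ψ : Literature.NumberTheory.GaloisRepresentations.FramedGaloisRep K (PadicAlgCl ℓ) 1), (∀ᶠ v in cofinite, ρ.IsUnramifiedAt v ∧ ψ.IsUnramifiedAt v ∧ ∀ 𝔓 ∈ v.primesAbove, ∀ σ : Field.absoluteGaloisGroup K, IsArithFrobAt (NumberField.RingOfIntegers K) σ 𝔓 → ψ.charpoly σ ∣ ρ.charpoly σ) → ∀ (ι : PadicAlgCl ℓ ≃+* ℂ), ∃ χ : Literature.NumberTheory.Automorphic.CuspidalAutomorphicRepData 1 K h1, χ.1.IsRegularAlgebraic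 ∧ ∀ᶠ v in cofinite, ∃ c : ℂ, χ.1.HasSatakeParamAt v {c} ∧ ψ.IsUnramifiedAt v ∧ ψ.HasFrobCharpolyAt v (Literature.NumberTheory.Automorphic.arithFrobPolyOfSatake ι v.residueCard 1 {c})) := by
    intro K _ _ h1 ℓ _ n E _ _ e ρ hss hrat ψ hψ ι
    obtain ⟨θ, hθalg, hθ⟩ :=
      Literature.NumberTheory.GaloisRepresentations.exists_heckeCharacter_of_weaklyDivides_holds K ℓ n E e ρ hss hrat ψ
        (Literature.NumberTheory.GaloisRepresentations.FramedGaloisRep.WeaklyDivides.of_eventually hψ) ι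
    obtain ⟨τ, hW, hW'⟩ := Literature.NumberTheory.Automorphic.exists_automorphicRepData_detTwist_glOne h1 θ
    have hcusp : τ.W ≤ Literature.NumberTheory.Automorphic.cuspFormsGL 1 K h1 := by
      rw [hW, Submodule.span_le]
      rintro _ rfl
      exact Literature.NumberTheory.Automorphic.IsCuspFormGL.mem_cuspFormsGL
        ⟨Literature.NumberTheory.Automorphic.isAutomorphicForm_detTwist_glOne h1 θ, fun k hk hk1 => absurd hk1 (by omega)⟩
    obtain ⟨p, q, hpq⟩ := (θ.isAlgebraic_iff_exists_hasInfinityType).1 hθalg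
    have hτreg : τ.IsRegularAlgebraic := by
      refine _root_.Summit.Langlands.Langlands.Theorems.AdjointLiftFromRegularTwist.isRegularAlgebraic_glOne_of_hasInfinityType
        τ (fun g φ hφ => ?_) hpq
      rw [hW] at hφ
      obtain ⟨a, rfl⟩ := Submodule.mem_span_singleton.1 hφ
      rw [hW', Submodule.mem_bot, map_smul, Literature.NumberTheory.Automorphic.rightTranslation_detTwist_glOne,
        smul_comm, Literature.NumberTheory.Automorphic.detTwist_apply', sub_self]
    obtain ⟨𝔪, h𝔪, hθ𝔪⟩ := Literature.NumberTheory.GaloisRepresentations.HeckeCharacter.exists_level_glOne θ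
    refine ⟨⟨τ, hcusp⟩, hτreg, ?_⟩
    filter_upwards [hθ, (Ideal.finite_factors h𝔪).compl_mem_cofinite] with v hv hw
    refine ⟨θ.valueAtUniformizer v, ?_, hv.2.1, ?_⟩
    · have h := Literature.NumberTheory.Automorphic.AutomorphicRepData.hasSatakeParamAt_detTwist_glOne h1 hW hW' h𝔪 hθ𝔪
        v hw (Literature.NumberTheory.GaloisRepresentations.HeckeCharacter.valued_uniformizer (K := K) v)
      simp only [Literature.NumberTheory.GaloisRepresentations.HeckeCharacter.valueAtUniformizer,
        Literature.NumberTheory.GaloisRepresentations.HeckeCharacter.localComponent_apply]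
      exact h
    · rw [Literature.NumberTheory.Automorphic.arithFrobPolyOfSatake_one, Multiset.map_singleton, Multiset.prod_singleton]
      exact hv.2.2
  have hRF := _root_.Summit.Langlands.Langlands.Theorems.ReducibleForcesEssSelfDual.reducibleForcesEssSelfDual_of hWA i6 i4 i5
  have hES := _root_.Summit.Langlands.Langlands.Theorems.GaloisRepOfRegularAlgebraic.essSelfDualIrreducibleCM_of_gl2CM_ae i2 i3 c2
  intro F _ _
  obtain ⟨hne, hall⟩ := cE F
  refine ⟨hne, fun Rec n hn hcpt => ?_⟩
  obtain ⟨hA, hB⟩ := hall Rec n hn hcpt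
  refine ⟨fun π hL ℓ _ ι => ?_, hB⟩
  -- irreducibility of EVERY avatar Satake–Frobenius compatible a.e. with `π`: sector dispatch
  have irr : ∀ ρ : Literature.NumberTheory.GaloisRepresentations.FramedGaloisRep F (PadicAlgCl ℓ) n,
      (∀ᶠ v : IsDedekindDomain.HeightOneSpectrum (NumberField.RingOfIntegers F) in Filter.cofinite,
        SatakeFrobCompatibleAt ι π.1 ρ v) → ρ.toGaloisRep.IsIrreducible := by
    intro ρ hρ
    by_cases hs : (n = 3 ∧ NumberField.IsCMField F ∧
        ∃ T : Literature.NumberTheory.Automorphic.InfinityType F n, π.1.HasInfinityType T ∧ T.IsRegular)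
    · -- IN the sector: the body of `IrreducibleGL3CM.frame_proof`, Galois input GaloisRepGL2CMae
      obtain ⟨rfl, hCM, T₂, hT₂, hR₂⟩ := hs
      have hRA : π.1.IsRegularAlgebraic := by
        obtain ⟨T₁, hT₁, hL₁⟩ := hL
        refine ⟨T₁, hT₁, (Literature.NumberTheory.Automorphic.InfinityType.isCAlgebraic_iff_isLAlgebraic_of_odd
          (by decide : Odd 3) T₁).mpr hL₁, fun σ => ?_⟩
        rw [Literature.NumberTheory.Automorphic.AutomorphicRepData.HasInfinityType.map_a_eq π.1 hT₁ hT₂ σ]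
        exact hR₂ σ
      -- cyclotomic untwist, then continuous semisimplification, both compatible a.e. (`m = 3` normalisation)
      obtain ⟨ρ', himp, hρ'v⟩ :=
        _root_.Summit.Langlands.Langlands.Theorems.IrreducibleGL3CM.stub_cyclotomicUntwist F ℓ ι ρ
      have hρ' : ∀ᶠ v : IsDedekindDomain.HeightOneSpectrum (NumberField.RingOfIntegers F) in Filter.cofinite,
          ∀ α : Multiset ℂ, π.1.HasSatakeParamAt v α → ρ'.IsUnramifiedAt v ∧
            ρ'.HasFrobCharpolyAt v (Literature.NumberTheory.Automorphic.arithFrobPolyOfSatake ι v.residueCard 3 α) := by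
        filter_upwards [hρ,
          Literature.NumberTheory.GaloisRepresentations.FramedGaloisRep.eventually_natCast_not_mem F ℓ] with v hv hℓ
        obtain ⟨α₀, hα₀, hur, hcp⟩ := hv
        intro α hα
        obtain rfl : α = α₀ :=
          Literature.NumberTheory.Automorphic.AutomorphicRepData.hasSatakeParamAt_unique_holds π.1 hα hα₀
        exact ⟨(hρ'v v hℓ hur).1, (hρ'v v hℓ hur).2 α hcp⟩
      obtain ⟨r, hrss, hrcp, hrker⟩ :=
        _root_.Summit.Langlands.Langlands.Theorems.IrreducibleGL3CM.stub_continuousSemisimplification F ℓ 3 ρ'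
      have hr : ∀ᶠ v : IsDedekindDomain.HeightOneSpectrum (NumberField.RingOfIntegers F) in Filter.cofinite,
          ∀ α : Multiset ℂ, π.1.HasSatakeParamAt v α → r.IsUnramifiedAt v ∧
            r.HasFrobCharpolyAt v (Literature.NumberTheory.Automorphic.arithFrobPolyOfSatake ι v.residueCard 3 α) := by
        filter_upwards [hρ'] with v hv α hα
        exact ⟨fun 𝔓 h𝔓 σ hσ => hrker σ ((hv α hα).1 𝔓 h𝔓 σ hσ),
          fun 𝔓 h𝔓 σ hσ => (hrcp σ).trans ((hv α hα).2 𝔓 h𝔓 σ hσ)⟩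
      -- dispatch: a reducible `ρ` has a reducible semisimple companion `r` (Brauer–Nesbitt), made essentially
      -- self-dual without three stable lines by ReducibleForcesEssSelfDual, hence irreducible by EssSelfDualIrreducibleCM
      by_contra hirr
      have hrirr : ¬ r.toGaloisRep.IsIrreducible :=
        _root_.Summit.Langlands.Langlands.Theorems.IrreducibleGL3CM.stub_not_isIrreducible_of_charpoly_eq
          F ℓ 3 ρ' r hrss hrcp (fun h' => hirr (himp h'))
      have h1 := Literature.NumberTheory.Automorphic.isCompact_glFiniteIntegralLevel_holds 1 F
      obtain ⟨hess, h3⟩ := hRF F h1 hcpt π hRA ℓ ι r hrss hr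
      exact hrirr (hES F hCM h1 hcpt π hRA (hess hrirr) ℓ ι r hrss hr h3)
    · exact cO n F hcpt hn π hL hs ℓ ι ρ hρ
  obtain ⟨ρ, hgeo, hcorr⟩ := hA π hL ℓ ι
  refine ⟨ρ, irr ρ hcorr.1, hgeo, hcorr, fun ρ' hcorr' => ?_⟩
  -- uniqueness up to conjugacy: irreducible ⇒ semisimple; equal Satake parameters a.e. (Flath) ⇒ equal Frobenius
  -- polynomials a.e. ⇒ equivalent (Chebotarev + Brauer–Nesbitt) ⇒ conjugate
  have hs1 : ρ.toGaloisRep.IsSemisimple := by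
    haveI := irr ρ hcorr.1
    change ComplementedLattice _
    infer_instance
  have hs2 : ρ'.toGaloisRep.IsSemisimple := by
    haveI := irr ρ' hcorr'.1
    change ComplementedLattice _
    infer_instance
  have hev : ∀ᶠ v : IsDedekindDomain.HeightOneSpectrum (NumberField.RingOfIntegers F) in Filter.cofinite,
      ρ.IsUnramifiedAt v ∧ ρ'.IsUnramifiedAt v ∧
        ∃ P : Polynomial (PadicAlgCl ℓ), ρ.HasFrobCharpolyAt v P ∧ ρ'.HasFrobCharpolyAt v P := by
    filter_upwards [hcorr.1, hcorr'.1] with v hv hv'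
    obtain ⟨α, hα, hur, hcp⟩ := hv
    obtain ⟨α', hα', hur', hcp'⟩ := hv'
    obtain rfl : α = α' :=
      Literature.NumberTheory.Automorphic.AutomorphicRepData.hasSatakeParamAt_unique_holds π.1 hα hα'
    exact ⟨hur, hur', _, hcp, hcp'⟩
  obtain ⟨e⟩ :=
    Literature.NumberTheory.GaloisRepresentations.FramedGaloisRep.nonempty_equiv_of_hasFrobCharpolyAt_eventually
      Literature.NumberTheory.Automorphic.chebotarev_artinRep_holds ρ ρ' hs1 hs2 hev
  obtain ⟨P, hP⟩ := Literature.NumberTheory.GaloisRepresentations.FramedRep.exists_eq_conj_of_equiv ρ ρ' e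
  exact ⟨P, hP.symm⟩

end Summit.Langlands.Langlands.Theorems
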